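import Mathlib.RingTheory.ZMod.UnitsCyclic
import Mathlib.NumberTheory.Multiplicity
import Mathlib.RingTheory.Ideal.Quotient.Operations
import HarnessLib

/-!
# Ring identities for the defect calculus of unit cocycles along `p`-adic thickenings

Elementary commutative algebra used by the obstruction theory for lifting Čech `1`-cocycles of
units along a tower of closed subschemes `Y_n ↪ X` cut out by `pⁿ`
(`Modules/UnitCocycleTowerLift.lean`) and by the Teichmüller-type transport of classes of line
bundles along such towers. In a commutative ring `R` (sections of `𝒪_X` over an affine open), with
`p` a natural number:

* `mul_mul_eq_of_coboundary_rel` — the identity behind "a cocycle modulo `pⁿ` whose class lifts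
  modulo `pⁿ⁺¹` has a coboundary as obstruction": working modulo `pⁿ⁺¹` (so that `π = pⁿ` has
  `π² = 0 = πp`), the coboundary relation `G_{ab} λ_b = λ_a L_{ab} + π r_{ab}` with `L` an honest
  cocycle forces `G_{ab} G_{bc} = G_{ac} (1 + π (v_{bc} - v_{ac} + v_{ab}))`,
  `v_{ab} = H_{ab} r_{ab} μ_b`;
* `corrected_mul_eq` — conversely `G'_{ab} = G_{ab}(1 - π v_{ab})` is then a cocycle modulo `π²`;
* `exists_one_add_pow_prime_pow_mul` — for an odd prime `p` and `M ≥ 1`,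
  `(1 + p^M y)^{p^e N} = 1 + N p^{M+e} y + p^{M+e+1} z` (from Mathlib's
  `ZMod.exists_one_add_mul_pow_prime_pow_eq`);
* `exists_transport_pow` — hence a defect `G_{ab} G_{bc} = G_{ac} + p^M y₀` becomes, after raising
  to the power `p^e N`, a defect `≡ G^{p^eN}_{ac}(1 + N p^{M+e} ỹ)` modulo `p^{M+e+1}` with the
  SAME reduction `ỹ`;
* `exists_eq_add_mul_of_defect_eq` (uniqueness of the obstruction cochain modulo `p` in a
  `p`-torsion-free ring), `exists_defect_descend` (prime-to-`p` division), and small helpers on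
  units modulo powers (`exists_one_add_mul_pow_eq`, `exists_mul_eq_one_add_pow_mul`,
  `exists_eq_add_mul_of_mk_eq`).

Everything is proved; no named facts; no definitions.

## References

* R. Hartshorne, *Algebraic Geometry*, GTM 52 (1977), III Ex. 4.6 (the sequence
  `0 → 𝓘 → 𝒪^×_{X} → 𝒪^×_{X₀} → 1`). [Hartshorne1977]
-/

namespace Literature.AlgebraicGeometry.Modules

/-! ### The two cocycle identities -/

/-- **Forward identity.** In a commutative ring with elements `π`, `ϖ` such that `π² = 0 = πϖ`
(think `π = pⁿ`, `ϖ = p` modulo `pⁿ⁺¹`): if `G_{ab} λ_b = λ_a L_{ab} + π r_{ab}` (a coboundary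
relation modulo `π` with defects `r`), `L` satisfies the cocycle identity, `λ μ = 1 (mod π)` and
`G H = 1 (mod ϖ)`, then `G_{ab} G_{bc} = G_{ac}(1 + π(v_{bc} - v_{ac} + v_{ab}))` with
`v_{ab} = H_{ab} r_{ab} μ_b`. [folklore] -/
theorem mul_mul_eq_of_coboundary_rel {Q : Type*} [CommRing Q] {π ϖ : Q} (hππ : π * π = 0)
    (hπϖ : π * ϖ = 0)
    {Gab Gbc Gac La Lb Lc Mb Mc Lab Lbc Lac rab rbc rac wb wc Hab Hbc Hac eab ebc eac : Q}
    (h3ab : Gab * Lb = La * Lab + π * rab) (h3bc : Gbc * Lc = Lb * Lbc + π * rbc)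
    (h3ac : Gac * Lc = La * Lac + π * rac) (h1 : Lab * Lbc = Lac)
    (h2b : Lb * Mb = 1 + π * wb) (h2c : Lc * Mc = 1 + π * wc)
    (hUab : Gab * Hab = 1 + ϖ * eab) (hUbc : Gbc * Hbc = 1 + ϖ * ebc)
    (hUac : Gac * Hac = 1 + ϖ * eac) :
    Gab * Gbc = Gac * (1 + π * (Hbc * rbc * Mc - Hac * rac * Mc + Hab * rab * Mb)) := by
  have S1ab : Gab = La * Lab * Mb + π * (rab * Mb - wb * Gab) := by
    linear_combination Mb * h3ab - Gab * h2b
  have S1bc : Gbc = Lb * Lbc * Mc + π * (rbc * Mc - wc * Gbc) := by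
    linear_combination Mc * h3bc - Gbc * h2c
  have S1ac : Gac = La * Lac * Mc + π * (rac * Mc - wc * Gac) := by
    linear_combination Mc * h3ac - Gac * h2c
  have S2 : (La * Lab * Mb) * (Lb * Lbc * Mc) = La * Lac * Mc + π * wb * (La * Lac * Mc) := by
    linear_combination (La * Lab * Lbc * Mc) * h2b + (La * Mc * (1 + π * wb)) * h1
  have S3 : Gab * Gbc = Gac + π * (-(rac * Mc - wc * Gac) + wb * Gac +
      Gab * (rbc * Mc - wc * Gbc) + Gbc * (rab * Mb - wb * Gab)) := by
    linear_combination (Gbc - π * (rbc * Mc - wc * Gbc)) * S1ab + (La * Lab * Mb) * S1bc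
      - (1 + π * wb) * S1ac + S2
      - (wb * (rac * Mc - wc * Gac) + (rab * Mb - wb * Gab) * (rbc * Mc - wc * Gbc)) * hππ
  linear_combination (1 - (wc + wb) * π + π * rbc * Mc * Hbc + π * rab * Mb * Hab) * S3
    + (-(wc + wb) + rbc * Mc * Hbc + rab * Mb * Hab) *
        (-(rac * Mc - wc * Gac) + wb * Gac + Gab * (rbc * Mc - wc * Gbc) +
          Gbc * (rab * Mb - wb * Gab)) * hππ
    + (rac * Mc * eac - rbc * Mc * Gab * ebc - rab * Mb * Gbc * eab) * hπϖ
    + (π * rac * Mc) * hUac - (π * rbc * Mc * Gab) * hUbc - (π * rab * Mb * Gbc) * hUab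

/-- **Backward identity.** If `π² = 0` and
`G_{ab} G_{bc} = G_{ac}(1 + π(v_{bc} - v_{ac} + v_{ab}))`, then the corrected elements `G'_{ab} = G_{ab}(1 - π v_{ab})` satisfy the cocycle identity
`G'_{ab} G'_{bc} = G'_{ac}`. [folklore] -/
theorem corrected_mul_eq {Q : Type*} [CommRing Q] {π : Q} (hππ : π * π = 0)
    {Gab Gbc Gac vab vbc vac : Q} (h : Gab * Gbc = Gac * (1 + π * (vbc - vac + vab))) :
    (Gab * (1 - π * vab)) * (Gbc * (1 - π * vbc)) = Gac * (1 - π * vac) := by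
  linear_combination (1 - π * vab) * (1 - π * vbc) * h
    + (Gac * (vab * vbc - (vbc - vac + vab) * (vab + vbc)) +
        π * vab * vbc * Gac * (vbc - vac + vab)) * hππ

/-! ### Units modulo powers -/

/-- `(1 + q e)^K = 1 + q e'` for some `e'`. [folklore] -/
theorem exists_one_add_mul_pow_eq {R : Type*} [CommRing R] (q e : R) (K : ℕ) :
    ∃ e' : R, (1 + q * e) ^ K = 1 + q * e' := by
  obtain ⟨r, hr⟩ := sub_dvd_pow_sub_pow (1 + q * e) 1 K
  rw [one_pow, add_sub_cancel_left] at hr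
  exact ⟨e * r, by linear_combination hr⟩

/-- An element invertible modulo `q` is invertible modulo every power of `q`:
`G H = 1 + q e ⟹ G H' = 1 + q^{K+1} w`. [folklore] -/
theorem exists_mul_eq_one_add_pow_mul {R : Type*} [CommRing R] {q G H e : R}
    (h : G * H = 1 + q * e) (K : ℕ) : ∃ H' w : R, G * H' = 1 + q ^ (K + 1) * w := by
  induction K with
  | zero => exact ⟨H, e, by rw [h, zero_add, pow_one]⟩
  | succ K ih =>
    obtain ⟨H', w, hw⟩ := ih
    exact ⟨H' * (1 - q ^ (K + 1) * w), -(q ^ K * w ^ 2), by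
      linear_combination (1 - q ^ (K + 1) * w) * hw⟩

/-- From an equality in `R ⧸ (q)` to an equation `a = b + q z` in `R`. [folklore] -/
theorem exists_eq_add_mul_of_mk_eq {R : Type*} [CommRing R] {q a b : R}
    (h : Ideal.Quotient.mk (Ideal.span {q}) a = Ideal.Quotient.mk (Ideal.span {q}) b) :
    ∃ z : R, a = b + q * z := by
  obtain ⟨z, hz⟩ := Ideal.mem_span_singleton'.mp (Ideal.Quotient.eq.mp h)
  exact ⟨z, by linear_combination -hz⟩

/-! ### Powers of defects: the transport computation -/

/-- **`(1 + p^M y)^{p^e N} ≡ 1 + N p^{M+e} y (mod p^{M+e+1})`** for an odd prime `p` and `M ≥ 1`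
(binomial valuations; the case `e = 1`, `N = 1` is `(1 + p^M y)^p ≡ 1 + p^{M+1} y (mod p^{M+2})`,
which fails for `p = 2`, `M = 1`). [folklore] -/
theorem exists_one_add_pow_prime_pow_mul {R : Type*} [CommRing R] {p : ℕ} (hp : p.Prime)
    (hp2 : p ≠ 2) {M : ℕ} (hM : 1 ≤ M) (y : R) (e N : ℕ) :
    ∃ z : R, (1 + (p : R) ^ M * y) ^ (p ^ e * N) =
      1 + (N : R) * (p : R) ^ (M + e) * y + (p : R) ^ (M + e + 1) * z := by
  obtain ⟨M, rfl⟩ : ∃ M', M = M' + 1 := ⟨M - 1, by omega⟩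
  have h3 : 3 ≤ p := by have := hp.two_le; omega
  obtain ⟨x, hx⟩ := ZMod.exists_one_add_mul_pow_prime_pow_eq (R := R) (u := (p : R) ^ (M + 1))
    (v := (p : R)) hp (dvd_pow_self _ (Nat.succ_ne_zero M)) (by
      rw [← pow_succ', ← pow_succ, ← pow_mul]
      exact pow_dvd_pow _ (by have := Nat.mul_le_mul_left (M + 1) h3; omega)) y e
  set w : R := (p : R) ^ e * (p : R) ^ (M + 1) * (y + (p : R) * x) with hw
  obtain ⟨T, hT⟩ := sq_dvd_add_pow_sub_sub w 1 N
  rw [one_pow, one_pow, one_mul] at hT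
  refine ⟨(N : R) * x + (p : R) ^ (M + e) * (y + (p : R) * x) ^ 2 * T, ?_⟩
  rw [pow_mul, hx, show (1 + w) ^ N = 1 + w * N + w ^ 2 * T by linear_combination hT, hw]
  ring

/-- **Transport of a defect through the power `p^e N`.** Let `p` be an odd prime, `M ≥ 1`, and
`G_{ab} G_{bc} = G_{ac} + p^M y₀` with `G_{ac}` invertible modulo `p`. Then for some `ỹ`:
`G_{ab} G_{bc} ≡ G_{ac}(1 + p^M ỹ)` and `(G_{ab} G_{bc})^{p^eN} ≡ G_{ac}^{p^eN}(1 + N p^{M+e} ỹ)`,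
both modulo `p^{M+e+1}`. [folklore] -/
theorem exists_transport_pow {R : Type*} [CommRing R] {p : ℕ} (hp : p.Prime) (hp2 : p ≠ 2)
    {M : ℕ} (hM : 1 ≤ M) (e N : ℕ) {Gab Gbc Gac Hac y₀ c : R}
    (hC : Gab * Gbc = Gac + (p : R) ^ M * y₀) (hU : Gac * Hac = 1 + (p : R) * c) :
    ∃ yt z₁ z₂ : R, Gab * Gbc = Gac * (1 + (p : R) ^ M * yt) + (p : R) ^ (M + e + 1) * z₁ ∧
      (Gab * Gbc) ^ (p ^ e * N) =
        Gac ^ (p ^ e * N) * (1 + (N : R) * (p : R) ^ (M + e) * yt) +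
          (p : R) ^ (M + e + 1) * z₂ := by
  obtain ⟨H', w, hw⟩ := exists_mul_eq_one_add_pow_mul hU (M + e)
  have h1 : Gab * Gbc = Gac * (1 + (p : R) ^ M * (H' * y₀)) +
      (p : R) ^ (M + e + 1) * (-((p : R) ^ M * w * y₀)) := by
    linear_combination hC - (p : R) ^ M * y₀ * hw
  obtain ⟨r, hr⟩ := sub_dvd_pow_sub_pow (Gac * (1 + (p : R) ^ M * (H' * y₀)) +
    (p : R) ^ (M + e + 1) * (-((p : R) ^ M * w * y₀))) (Gac * (1 + (p : R) ^ M * (H' * y₀)))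
    (p ^ e * N)
  rw [add_sub_cancel_left, ← h1, mul_pow Gac] at hr
  obtain ⟨z, hz⟩ := exists_one_add_pow_prime_pow_mul hp hp2 hM (H' * y₀) e N
  refine ⟨H' * y₀, _, Gac ^ (p ^ e * N) * z + -((p : R) ^ M * w * y₀) * r, h1, ?_⟩
  linear_combination hr + Gac ^ (p ^ e * N) * hz

/-- **Uniqueness of the obstruction cochain modulo `p`.** In a ring where `p` is a
non-zero-divisor, if `G(1 + p^L x₁) + p^{L+1} z₁ = G(1 + p^L x₂) + p^{L+1} z₂` with `G` invertible
modulo `p`, then `x₁ ≡ x₂ (mod p)`. [folklore] -/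
theorem exists_eq_add_mul_of_defect_eq {R : Type*} [CommRing R] {p : ℕ}
    (htf : ∀ s : R, (p : R) * s = 0 → s = 0) (L : ℕ) {G H c x₁ x₂ z₁ z₂ : R}
    (hU : G * H = 1 + (p : R) * c)
    (h : G * (1 + (p : R) ^ L * x₁) + (p : R) ^ (L + 1) * z₁ =
      G * (1 + (p : R) ^ L * x₂) + (p : R) ^ (L + 1) * z₂) :
    ∃ d : R, x₁ = x₂ + (p : R) * d := by
  have htfL : ∀ (n : ℕ) (s : R), (p : R) ^ n * s = 0 → s = 0 := by
    intro n
    induction n with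
    | zero => intro s hs; simpa using hs
    | succ n ih => intro s hs; exact htf s (ih _ (by rw [pow_succ, mul_assoc] at hs; exact hs))
  refine ⟨H * (z₂ - z₁) - c * (x₁ - x₂), ?_⟩
  rw [← sub_eq_zero]
  refine htfL L _ ?_
  linear_combination H * h - (p : R) ^ L * (x₁ - x₂) * hU

/-- **Prime-to-`p` division of the obstruction.** If `N α = 1 + p β`,
`G_{ab}G_{bc} = G_{ac}(1 + p^M ỹ) + p^{M+e+1} z₁` and `N ỹ = D + p d`, then
`G_{ab}G_{bc} = G_{ac}(1 + p^M α D) + p^{M+1} z` for some `z`. [folklore] -/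
theorem exists_defect_descend {R : Type*} [CommRing R] {p N α β M e : ℕ}
    (hBez : N * α = p * β + 1) {Gab Gbc Gac yt z₁ D d : R}
    (h1 : Gab * Gbc = Gac * (1 + (p : R) ^ M * yt) + (p : R) ^ (M + e + 1) * z₁)
    (h7 : (N : R) * yt = D + (p : R) * d) :
    ∃ z : R, Gab * Gbc = Gac * (1 + (p : R) ^ M * ((α : R) * D)) + (p : R) ^ (M + 1) * z := by
  have hB : (N : R) * (α : R) = (p : R) * (β : R) + 1 := by
    exact_mod_cast congrArg (Nat.cast (R := R)) hBez
  exact ⟨Gac * ((α : R) * d - (β : R) * yt) + (p : R) ^ e * z₁, by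
    linear_combination h1 - (p : R) ^ M * Gac * yt * hB + (p : R) ^ M * Gac * (α : R) * h7⟩

end Literature.AlgebraicGeometry.Modules
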